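/-
Copyright (c) 2026 the pub-hodgecm-mathlib formalisation cell (harness21).  Prover seat hodgecm-mathlib-K2Liu-p08 (g4), Track B «K2-LIT» ∕ hLiu418
#184♮, socket #42S organ S1 (ROAD W), brick F7 (dual «⇒» reading step, inert) (K2Liu-p01 (g8) 12:55:40Z «(dual «⇒» reading step) p08∕p06»; SPEC-F7-PhaseChain
e96aa88172f3bbd5 §2).  2026-09-04.  KERNEL: theorems only.
-/
import Summits.HodgeConjecture.HodgeConjecture.Theorems.K2LiuHermitianTraceSelfDuality   -- ★ p860294 (K2Liu-p01): `forall_trace_herm_mul_mem_iff` (hermitian tests, over `O`)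
import Summits.HodgeConjecture.HodgeConjecture.Theorems.K2LiuTraceDualityMatrixBox         -- ★ p860061: `valuation_trace_mul_le`
import HarnessLib

/-!
# Crux `HLiu418`, #42S-S1 ROAD W, brick (dual «⇒» reading step, inert): ★ (hDW-alg)'s HERMITIAN TRACE DUALITY READ IN THE FIELD (valuation currency)

Cell `hodgecm-mathlib`, crux item hLiu418 = `stmt-HodgeConjecture-24832` (helper lane `--supports … --as helper`, count-neutral).  THEOREMS ONLY (no `def`, no instance,
no notation, no named-fact hypothesis, no `sorry`).  K2Liu-p01 (g8)'s ★ (hDW-alg) `K2LiuHermitianTraceSelfDuality.forall_trace_herm_mul_mem_iff` is stated over the DVR `O`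
with an ideal `I` (`∀ H ∈ Herm_n(O), tr(H·G) ∈ I ↔ G ∈ I·Herm`); the LAST FILE's phase chain (★ (Φ4)–(Φ8)) produces the tests and the Gram in the FIELD `K = E_{w₀}` (after ★ inert
reading p860085) with VALUATION bounds.  This file is the passage, GENERIC and BY VALUE exactly as ★ (iii-b) p860141 (`alg : O →+* K` injective, `hint`, `hsurj`, the involutions
`σ`, `σK` with `alg ∘ σ = σK ∘ alg`, and the dictionary `hIv : z ∈ I ↔ vK (alg z) ≤ ρ` — at `I = 𝔪^m`: ★ `adicCompletionIntegers.mem_maximalIdeal_pow_iff`, `ρ = vK(ϖ)^m`):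
* `herm_lift_of_reading` (an integral `σK`-hermitian `Y` over `K` is `H.map alg` for a `σ`-hermitian `H` over `O`), `alg_trace_mul` (`alg (tr(H·G)) = tr(H.map alg · G.map alg)`),
  ★★ HEAD **`forall_herm_trace_le_iff_of_reading`**: `(∀ Y σK-hermitian with entries vK ≤ 1, vK(tr(Y · G.map alg)) ≤ ρ) ↔ ∀ i j, vK(alg (G i j)) ≤ ρ` for `σ`-hermitian `G` over `O`
  (UNRAMIFIED involution: `IsUnit (σ a − a)`, `σ(I) ⊆ I`) — the «⇒» half is ★ (hDW-alg), the «⇐» half is ★ `valuation_trace_mul_le`.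
The split twin is ★ p860314 `K2LiuSplitHermitianTraceDuality` (all-`Y` tests).  [Shimura1997, §13.2] [Jacobowitz1962, §4] [Weil1964, §20].
HONEST LABEL.  Count-neutral helper; `HC_CM` is proved only modulo the 7 printed citations (2 remaining named inputs: hLiu418 = `stmt-HodgeConjecture-24832`,
h413 = `stmt-HodgeConjecture-24833`) until rung 0 closes.

## References
* [Shimura1997] G. Shimura, CBMS 93 (1997), §13.2.   * [Jacobowitz1962] R. Jacobowitz, Amer. J. Math. 84 (1962), §4.   * [Weil1964] A. Weil, Acta Math. 111 (1964), §20.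
-/

set_option autoImplicit false
set_option linter.dupNamespace false -- the mandated namespace repeats `HodgeConjecture.HodgeConjecture`

open Matrix

namespace Summit.HodgeConjecture.HodgeConjecture.Cruxes.HLiu418.K2LiuInertHermitianTraceDualityReading

open K2LiuHermitianTraceSelfDuality K2LiuTraceDualityMatrixBox

variable {O : Type*} [CommRing O] {K : Type*} [Field K] {Γ₀ : Type*} [LinearOrderedCommGroupWithZero Γ₀]
  (vK : Valuation K Γ₀) (alg : O →+* K) (halg : Function.Injective alg) (hint : ∀ z : O, vK (alg z) ≤ 1) (hsurj : ∀ y : K, vK y ≤ 1 → ∃ z : O, alg z = y)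
  (σ : O →+* O) (σK : K →+* K) (hσalg : ∀ z : O, alg (σ z) = σK (alg z))
  {n : Type*} [Fintype n] [DecidableEq n]

omit [Fintype n] [DecidableEq n] in
include halg hsurj hσalg in
/-- **an integral `σK`-hermitian matrix over `K` lifts to a `σ`-hermitian matrix over `O`.** [cite: Jacobowitz1962, §4] -/
theorem herm_lift_of_reading (Y : Matrix n n K) (hY : ∀ k l, σK (Y k l) = Y l k) (hYint : ∀ k l, vK (Y k l) ≤ 1) :
    ∃ H : Matrix n n O, (∀ k l, σ (H k l) = H l k) ∧ H.map alg = Y := by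
  choose Hf hHf using fun k l => hsurj _ (hYint k l)
  refine ⟨of Hf, fun k l => halg ?_, Matrix.ext fun k l => hHf k l⟩
  rw [hσalg]
  show σK (alg (Hf k l)) = alg (Hf l k)
  rw [hHf, hHf, hY]

omit [DecidableEq n] in
/-- `alg (tr(H·G)) = tr(H.map alg · G.map alg)`. [folklore] -/
theorem alg_trace_mul (H G : Matrix n n O) : alg (trace (H * G)) = trace (H.map alg * G.map alg) := by
  rw [AddMonoidHom.map_trace alg (H * G), Matrix.map_mul]

include hint hσalg in
/-- **★ (hDW-alg) READ IN THE FIELD** (HEAD): for an unramified involution (`σ² = id`, `σ a − a` a unit, `σ(I) ⊆ I`), a dictionary `z ∈ I ↔ vK(alg z) ≤ ρ`, and a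
`σ`-hermitian `G` over `O`: `(∀ Y σK-hermitian, (∀ k l, vK (Y k l) ≤ 1) → vK (tr(Y · G.map alg)) ≤ ρ) ↔ ∀ i j, vK (alg (G i j)) ≤ ρ`.
[cite: Shimura1997, §13.2] [cite: Weil1964, §20] -/
theorem forall_herm_trace_le_iff_of_reading (hσ : ∀ x, σ (σ x) = x) {a : O} (ha : IsUnit (σ a - a)) {I : Ideal O} (hI : ∀ x ∈ I, σ x ∈ I)
    {ρ : Γ₀} (hIv : ∀ z : O, z ∈ I ↔ vK (alg z) ≤ ρ) {G : Matrix n n O} (hG : ∀ i j, σ (G i j) = G j i) :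
    (∀ Y : Matrix n n K, (∀ k l, σK (Y k l) = Y l k) → (∀ k l, vK (Y k l) ≤ 1) → vK (trace (Y * G.map alg)) ≤ ρ) ↔ ∀ i j, vK (alg (G i j)) ≤ ρ := by
  constructor
  · intro h i j
    -- through ★ (hDW-alg): every hermitian test over `O` maps to an admissible `Y`
    refine (hIv _).1 ((forall_trace_herm_mul_mem_iff σ hσ ha hI hG).1 (fun H hH => (hIv _).2 ?_) i j)
    rw [alg_trace_mul]
    exact h _ (fun k l => by rw [Matrix.map_apply, Matrix.map_apply, ← hσalg, hH]) (fun k l => hint _)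
  · intro h Y _ hYint
    exact valuation_trace_mul_le vK hYint (fun i j => by rw [Matrix.map_apply]; exact h i j)

end Summit.HodgeConjecture.HodgeConjecture.Cruxes.HLiu418.K2LiuInertHermitianTraceDualityReading
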